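import Summits.Ventures.HodgeRepro2.T5CartanUniformiser

/-!
# The Cartan decomposition with a dominant representative: `GL_n(F) = ⋃_{a₁ ≤ … ≤ aₙ} K diag(ϖ^a) K`

Tier-5 kernel support (blind cell pub-hodge-repro2, seat p8, gen 11). `T5CartanUniformiser`
writes every `g ∈ GL_n(F)` as `k₁ · diag(ϖ^{m_i}) · k₂`; conjugating the diagonal by a permutation
matrix (which lies in `GL_n(R)`) sorts the exponents, so the representative can be taken
DOMINANT, `m_1 ≤ m_2 ≤ … ≤ m_n` — the form in which the printed Cartan decomposition indexes the
double cosets `K \ GL_n(F_v) / K` by dominant cocharacters.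

* `permUnit σ : GL ι A` — the permutation matrix of `σ` as an invertible matrix;
* `permMatrix_mul_diagonal_mul_permMatrix_inv` — `P_σ · diag(d) · P_σ⁻¹ = diag(d ∘ σ)`;
* `exists_cartan_dominant` — **`g = k₁ · diag(ϖ^{m_i}) · k₂` with `m` monotone** (`ι = Fin n`).

Hypotheses as stated in the kernel: those of `T5CartanUniformiser` (`R` a DVR with uniformiser
`ϖ`, `F` its fraction field); the index type is `Fin n` for the sorting (Mathlib's `Tuple.sort`).
The uniqueness of the dominant representative is NOT stated.
-/

namespace Summit.Ventures.HodgeRepro2.T5CartanDominant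

open Matrix

section Perm

variable {A : Type*} [CommRing A] {ι : Type*} [Fintype ι] [DecidableEq ι]

variable (A) in
/-- The permutation matrix of `σ` as an element of `GL ι A` (inverse: the matrix of `σ⁻¹`). -/
def permUnit (σ : Equiv.Perm ι) : GL ι A :=
  ⟨σ.permMatrix A, σ⁻¹.permMatrix A,
    by rw [← Matrix.permMatrix_mul, inv_mul_cancel, Matrix.permMatrix_one],
    by rw [← Matrix.permMatrix_mul, mul_inv_cancel, Matrix.permMatrix_one]⟩

/-- The matrix underlying `permUnit σ`. -/
@[simp] theorem coe_permUnit (σ : Equiv.Perm ι) :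
    (permUnit A σ : Matrix ι ι A) = σ.permMatrix A := rfl

/-- The matrix underlying `(permUnit σ)⁻¹`. -/
@[simp] theorem coe_permUnit_inv (σ : Equiv.Perm ι) :
    ((permUnit A σ)⁻¹ : GL ι A) = (σ⁻¹.permMatrix A : Matrix ι ι A) := rfl

/-- Conjugating a diagonal matrix by a permutation matrix permutes the diagonal:
`P_σ · diag(d) · P_σ⁻¹ = diag(d ∘ σ)`. -/
theorem permMatrix_mul_diagonal_mul_permMatrix_inv (σ : Equiv.Perm ι) (d : ι → A) :
    σ.permMatrix A * diagonal d * σ⁻¹.permMatrix A = diagonal (d ∘ σ) := by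
  rw [Equiv.Perm.permMatrix, Equiv.Perm.permMatrix, PEquiv.toMatrix_toPEquiv_mul,
    Equiv.Perm.inv_def, PEquiv.mul_toMatrix_toPEquiv, Equiv.symm_symm,
    Matrix.submatrix_submatrix, Function.comp_id, Function.id_comp, Matrix.submatrix_diagonal_equiv]

/-- The reverse form: `diag(d) = P_σ⁻¹ · diag(d ∘ σ) · P_σ`. -/
theorem diagonal_eq_permMatrix_inv_mul_mul_permMatrix (σ : Equiv.Perm ι) (d : ι → A) :
    diagonal d = σ⁻¹.permMatrix A * diagonal (d ∘ σ) * σ.permMatrix A := by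
  have h1 : σ⁻¹.permMatrix A * σ.permMatrix A = 1 := by
    rw [← Matrix.permMatrix_mul, mul_inv_cancel, Matrix.permMatrix_one]
  rw [← permMatrix_mul_diagonal_mul_permMatrix_inv σ d]
  calc diagonal d = 1 * diagonal d * 1 := by rw [one_mul, mul_one]
    _ = (σ⁻¹.permMatrix A * σ.permMatrix A) * diagonal d *
          (σ⁻¹.permMatrix A * σ.permMatrix A) := by rw [h1]
    _ = _ := by simp only [mul_assoc]

/-- The image of a permutation matrix under a ring homomorphism is the permutation matrix. -/
theorem map_permUnit {B : Type*} [CommRing B] (f : A →+* B) (σ : Equiv.Perm ι) :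
    Matrix.GeneralLinearGroup.map f (permUnit A σ) = permUnit B σ := by
  ext i j
  simp [Matrix.GeneralLinearGroup.map_apply, Equiv.Perm.permMatrix, PEquiv.toMatrix_apply,
    apply_ite f]

end Perm

variable {R : Type*} [CommRing R] [IsDomain R] [IsDiscreteValuationRing R]
variable {F : Type*} [Field F] [Algebra R F] [IsFractionRing R F]

/-- **The Cartan decomposition with a dominant representative**: every `g ∈ GL (Fin n) F` is
`k₁ · diag(ϖ^{m_0}, …, ϖ^{m_{n-1}}) · k₂` with `k₁, k₂ ∈ GL_n(R)` and `m` MONOTONE. -/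
theorem exists_cartan_dominant {n : ℕ} {ϖ : R} (hϖ : Irreducible ϖ) (g : GL (Fin n) F) :
    ∃ k₁ ∈ (Matrix.GeneralLinearGroup.map (n := Fin n) (algebraMap R F)).range,
      ∃ k₂ ∈ (Matrix.GeneralLinearGroup.map (n := Fin n) (algebraMap R F)).range,
        ∃ m : Fin n → ℤ, Monotone m ∧ (g : Matrix (Fin n) (Fin n) F) =
          (k₁ : Matrix (Fin n) (Fin n) F) * diagonal (fun i => algebraMap R F ϖ ^ m i) *
            (k₂ : Matrix (Fin n) (Fin n) F) := by
  obtain ⟨k₁, hk₁, k₂, hk₂, m, hg⟩ :=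
    T5CartanUniformiser.exists_cartan_uniformiser (R := R) hϖ g
  set σ : Equiv.Perm (Fin n) := Tuple.sort m with hσ
  refine ⟨k₁ * (permUnit F σ)⁻¹,
    Subgroup.mul_mem _ hk₁ (Subgroup.inv_mem _ ⟨permUnit R σ, map_permUnit _ _⟩),
    permUnit F σ * k₂, Subgroup.mul_mem _ ⟨permUnit R σ, map_permUnit _ _⟩ hk₂,
    m ∘ σ, Tuple.monotone_sort m, ?_⟩
  rw [hg, diagonal_eq_permMatrix_inv_mul_mul_permMatrix σ (fun i => algebraMap R F ϖ ^ m i),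
    Units.val_mul, Units.val_mul, coe_permUnit_inv, coe_permUnit]
  simp only [mul_assoc, Function.comp_def]

end Summit.Ventures.HodgeRepro2.T5CartanDominant
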